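import Literature.MathematicalPhysics.QuantumFieldTheory.Balaban1983to89.B13OpsYPencilDeltaALetters

/-!
# `Balaban1983to89.B13DeltaALocalFamily` — T. Bałaban, *Propagators for lattice gauge theories in a background field*, Commun. Math. Phys. **99** (1985) 389–434
# [Balaban1985BackgroundPropagators], (3.10) p. 392 (`Δ(U)`), (3.12)–(3.13) p. 392 (`Q`, `Q*`), (3.26) p. 395 («Δ_a(U) = Δ(U) + D_U R(U) D*_U + Q*(U)aQ(U)»), (3.35)–(3.37)
# p. 396 («|A′| < α₁(Lʲη)⁻¹ on Ω_j»), Thm 3.4 and (3.50) p. 400 («the operators … extend to configurations U′U … as analytic functions of A′»), Thm 3.10 (3.107)–(3.108)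
# p. 416; [Balaban1984PropagatorsII] (2.19) p. 226; [Balaban1988RG2Cluster] (2.5)–(2.7) pp. 12–13, p. 15: ★★ STATION W5 OF THE (3.37)-SCALED-PENCIL LEAF — THE LOCAL PART
# `Δ(U) + Q*(U)aQ(U)` OF NODE 00's `Δ_a(U)` ALONG **ANY** HOLOMORPHIC BACKGROUND FAMILY `F : A′ ↦ U(A′)` ON NODE 00's CHART, TRANSPORTER-GENERIC (the lane's modules 75 §3–§4
# and 76 §3–§4 re-issued with the bond-averaging transporter facts and the Hessian facts DISPLAYED), then the plain pencil `F := prodCfg U₀ η` as the instance of record.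

THE DISPLAY.  The lane's 75 ∕ 76 read the local part along pv27's plain pencil `U = e^{iηA′}U₀`: the bond averaging `Q ∕ Q*` transport along block paths of length
`D = (d+2)(L^k−1)`, costing `(K₀e^{|η|Rc})^D` (73), a k-DEPENDENT numeral.  dag-n10-w3 g5's LOCATED (c) (INBOX l.≈37990; lane census v21.2 items 5–6) records that the
ALL-INDEX k-uniform radius needs the (3.37)-SCALED pencil `A″ ↦ e^{iη(L^{lev z})⁻¹A″(z)}U₀`, whose leaf (W1–W3, dag-n10-w3) and block-by-block averaging letters (W4,
dag-n10-w5) give LEVEL-UNIFORM transporter numerals; «then 75 ∕ 76 ∕ 78 over W4 unchanged in shape» (INBOX l.39051).  THIS FILE is that re-read of 75 ∕ 76 ONCE FOR ALL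
FAMILIES: for ANY `F : (chart) → CfgY 𝔸 i`, ANY transporter letter `parB`, on the chart ball of radius `Rc`, DISPLAYED are (i) the bond-averaging transporter facts in
dag-n10-w6 g4's `B13DirichletLocalRProjLetters` §1 format — holomorphy `hQh ∕ hQhi` of `u ↦ qT i parB (F u) ι b` and of its inverse, and ONE numeral `0 ≤ K_Q` with
`hQf ∕ hQb` (`qK ι b ≠ 0 ⇒ ‖qT (F u) ι b‖, ‖(qT (F u) ι b)⁻¹‖ ≤ K_Q`) and `hQsf ∕ hQsb` (the same on `qsK`'s support) —, (ii) the Hessian facts — holomorphy `hHh` of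
`u ↦ (Δ(F u)Λ)(b)` and ONE numeral `0 ≤ M_H` with `hH : ‖(Δ(F u)Λ)(b)‖ ≤ M_H‖Λ‖` —, and (iii) 76's numerals (`c_Q, c_{Q*}, c_a`, basis `cb, cl`, the bond reading's `s`).
Concluded: `RawEntryLetters (u ↦ toMatrix B′B′ (Δ(F u) + (Q*aQ)(F u))) (ℓB ∘ fst) Rc ρ (cb·(M_H·cl + c_{Q*}(K_Q(c_a(c_Q(K_Q·cl·K_Q)))K_Q))·e^{ρs})` for every `ρ ≥ 0`.
§3: at the plain pencil (`F := prodCfg U₀ η`, `parB := parBY`) the displayed facts are 73's and 71's (`K_Q = (K₀e^{|η|Rc})^D`, `M_H` = 71's majorant at `‖Λ‖ = 1`) —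
76 §4's statement up to the bracketing of its constant (consistency).  The SCALED-pencil instance feeds W3 ∕ W4's level-uniform `K_Q` and 71-by-precomposition into §2 — a
successor's §4 once W4 §3 (`qT parBY` block by block) lands (its output binder = §2's input binder verbatim).

[folklore] the lane's own proofs of 75 §3–§4 ∕ 76 §3–§4 with the pencil-specific leaf lemmas replaced by the displayed hypotheses (75 §1 `norm_trLiftY_apply_le_of_support`,
70 `differentiableOn_trLiftY_apply`, 75 §2 `aY` facts, 76 §2 range facts, 56A `rawEntryLetters_of_range_family`, `rawEntryLetters_toMatrix_of_coordFamily` BY NAME); kernel-checked;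
THEOREMS ONLY (no `def`, no `structure`, no instance, no notation); NOTHING of NODE 00's ∕ pv27's ∕ the lane's ∕ dag-n10-w3's ∕ w5's ∕ w6's files is modified; nothing
here is a claim about the Yang–Mills mass gap; no node is discharged; count-neutral.

WHY THIS FILE (cell `pub-ymgap`, HUMAN RULING D-0062 ∕ D-0149, Track A node N10 = [B13]; WIDTH SEAT `pub-ymgap-dag-n10-w4` g6, OFFER-4 ∕ CLAIM-6 = STATION W5 (R455 (A);
first refusal dag-n10-w3 (road declarer), dag-n10-w5 (W4), the lane, def-Y); lane census v21.2 item 6 «W-LEAF … W4 … next seat ∕ gen», dag-n10-w3 g5 design note «stations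
GENERIC IN THE CHART AND THE BACKGROUND FAMILY … the scaled pencil is a later INSTANCE, not a rewrite»).  The local part is the input `hLoc` of this seat's located Δ_a assembly
(`B13DeltaAPencilLettersLocated` §2, `B13InverseLettersOnCoerciveBallLocated` §2) — the station upstream of my own located road.

WHAT THIS FILE PROVES (all `theorem`s; chart `E₀ = Fin (d+1) → Site (PV d ℓ i.m i.K hd hL) 0 → 𝔸`).
* §1 (ANY `F : E₀ → CfgY 𝔸 i`, ANY `parB`) `differentiableOn_QY_apply_of_family` · `differentiableOn_QsaQ_of_family` · `norm_QY_apply_le_of_family` (`≤ c_Q(K_Q‖Λ‖K_Q)`) ·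
  ★ `norm_QsaQ_le_of_family` (`≤ c_{Q*}(K_Q(c_a(c_Q(K_Q‖Λ‖K_Q)))K_Q)`) · `differentiableOn_localDeltaA_of_family` · ★ `norm_localDeltaA_le_of_family` · `differentiableOn_coord_localDeltaA_of_family`.
* §2 ★★ `rawEntryLetters_toMatrix_localDeltaA_of_family` — 76 §4's square packaging over §1.
* §3 ★ `rawEntryLetters_toMatrix_localDeltaA_prodCfg_of_family` — the plain-pencil instance (73's and 71's facts fed by name; = 76 §4 up to bracketing).
* §4 (the (3.37)-SCALED pencil `A″ ↦ e^{iη(w·A″)}U₀`, `|w| ≤ 1`, dag-n10-w3's W3 shape) `differentiable_weightScale` · `mapsTo_weightScale_ball` · ★ `differentiableOn_hessY_scaledPencil`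
  · ★ `differentiableOn_qT_scaledPencil` · ★ `norm_hessY_scaledPencil_le` — every §2 input for the scaled pencil EXCEPT the transporter numeral (`hQf hQb hQsf hQsb` = W4's).
HONEST FRAMING: letter algebra over DISPLAYED transporter ∕ Hessian facts; which family ∕ weight ∕ transporter letter is «of record» stays NODE 00's ∕ the lane's word; the
scaled-pencil instance of §2 is NOT assembled in this file (its transporter numeral is W4 §3's, pending) — §4 supplies every other input; nothing of Bałaban's asserted; N06 ∕ N10 NOT discharged; K1⁹ stmt-QuantumFields-27364 OPEN, no registered stub
proved; counts unmoved (typed 28∕28 · discharged 5∕27); 0 `def`, 0 `sorry`, standard axioms; one finite 𝕋⁴ programme at fixed ε, Bałaban AS PRINTED — R4 closes the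
conditional finite-𝕋⁴ rung `BalabanLadder.UV` only; the YM mass gap (Clay) is NOT proved by any of this; nothing continuum ∕ ℝ⁴ ∕ OS.  Filed `--kind proof --supports
stmt-QuantumFields-27364`, Literature lane.

References: T. Bałaban, CMP 99 (1985) 389–434 [Balaban1985BackgroundPropagators] (3.2) p.390, (3.10) p.392, (3.12)–(3.13) p.392, (3.26)–(3.27) p.395, (3.35)–(3.37) p.396,
(3.40) p.397, Thm 3.4 and (3.50) p.400, Thm 3.10 (3.107)–(3.108) p.416; CMP 96 (1984) 223–250 [Balaban1984PropagatorsII] (2.19) p.226; CMP 116 (1988) 1–22 [Balaban1988RG2Cluster]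
(2.5)–(2.7) pp.12–13, p.15.
-/

noncomputable section

namespace Literature.MathematicalPhysics.QuantumFieldTheory.Balaban1983to89.B13DeltaALocalFamily

open Metric Set Finset Module
open scoped Matrix
open Literature.MathematicalPhysics.QuantumFieldTheory.Balaban1983to89
open Literature.MathematicalPhysics.QuantumFieldTheory.Balaban1983to89.B9Thm37GlueTorus (tdist1)
open Literature.MathematicalPhysics.QuantumFieldTheory.Balaban1983to89.B5TorusCover (UT)
open Literature.MathematicalPhysics.QuantumFieldTheory.Balaban1983to89.B13EntrywiseWalks (RawEntryLetters)
open Literature.MathematicalPhysics.QuantumFieldTheory.Balaban1983to89.B13AccretiveOfRealCoercive (rawEntryLetters_of_range_family)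
open Literature.MathematicalPhysics.QuantumFieldTheory.Balaban1983to89.B13InverseOperatorCoordinates (rawEntryLetters_toMatrix_of_coordFamily)
open Literature.MathematicalPhysics.QuantumFieldTheory.Balaban1983to89.B9Eq39Adjoint (prodCfg)
open Literature.MathematicalPhysics.QuantumFieldTheory.Balaban1983to89.B6GlobalChartV1 (PV)
open Literature.MathematicalPhysics.QuantumFieldTheory.Balaban1983to89.B6KLevelCensusIndexV1 (KIdx)
open Literature.MathematicalPhysics.QuantumFieldTheory.Balaban1983to89.B15DeterminingSets (embIter)
open Literature.MathematicalPhysics.QuantumFieldTheory.Balaban1983to89.Node00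
  (FBondY IBondY PlaqY CfgY BondParY curlK cocurlK qK qsK aK qT edgeY hessY QY QsY aY parBY)
open Literature.MathematicalPhysics.QuantumFieldTheory.Balaban1983to89.B13OpsYPencilHolonomy (differentiableOn_trLiftY_apply)
open Literature.MathematicalPhysics.QuantumFieldTheory.Balaban1983to89.B13OpsYPencilHessian (differentiableOn_hessY_prodCfg norm_hessY_prodCfg_le)
open Literature.MathematicalPhysics.QuantumFieldTheory.Balaban1983to89.B13OpsYPencilAveraging
  (differentiableOn_qT_prodCfg differentiableOn_qT_inv_prodCfg norm_qT_prodCfg_le norm_qT_inv_prodCfg_le)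
open Literature.MathematicalPhysics.QuantumFieldTheory.Balaban1983to89.B13OpsYPencilDeltaALocal
  (norm_trLiftY_apply_le_of_support differentiableOn_aY_apply norm_aY_apply_le)
open Literature.MathematicalPhysics.QuantumFieldTheory.Balaban1983to89.B13OpsYPencilDeltaALetters (tdist_le_of_localDeltaA_single_ne_zero)

variable {𝔸 : Type} [NormedRing 𝔸] [NormedAlgebra ℂ 𝔸] [CompleteSpace 𝔸]
variable {d ℓ : ℕ} {hd : 1 ≤ d + 1} {hL : Odd (ℓ + 1) ∧ 1 < ℓ + 1} {b₀ b₁ : ℝ}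
variable (i : KIdx d ℓ hd hL b₀ b₁)
variable (parB : BondParY 𝔸 i) (F : (Fin (d + 1) → Site (PV d ℓ i.m i.K hd hL) 0 → 𝔸) → CfgY 𝔸 i) {Rc KQ MH : ℝ}

/-! ## §1. The bond-averaging sandwich and the local part along ANY holomorphic background family, transporter-generic -/

section Family

/-- ★ The bond averaging of a u-DEPENDENT holomorphic field along ANY family `F` is holomorphic: `u ↦ (Q(F u)Λ(u))(ι)`, given holomorphy `hQh ∕ hQhi` of the transporters
`u ↦ qT i parB (F u) ι b` and their inverses (75 `differentiableOn_QY_prodCfg_apply`, transporter-generic; `QY = trLiftY qK qT`).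
[cite: Balaban1985BackgroundPropagators, (3.12) p.392, Thm 3.4 and (3.50) p.400] -/
theorem differentiableOn_QY_apply_of_family
    (hQh : ∀ ι b, DifferentiableOn ℂ (fun u => (qT i parB (F u) ι b : 𝔸)) (ball (0 : Fin (d + 1) → Site (PV d ℓ i.m i.K hd hL) 0 → 𝔸) Rc))
    (hQhi : ∀ ι b, DifferentiableOn ℂ (fun u => (((qT i parB (F u) ι b)⁻¹ : 𝔸ˣ) : 𝔸)) (ball (0 : Fin (d + 1) → Site (PV d ℓ i.m i.K hd hL) 0 → 𝔸) Rc))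
    {Λ : (Fin (d + 1) → Site (PV d ℓ i.m i.K hd hL) 0 → 𝔸) → FBondY i → 𝔸} (hΛ : ∀ b, DifferentiableOn ℂ (fun u => Λ u b) (ball 0 Rc)) (ι : IBondY i) :
    DifferentiableOn ℂ (fun u => QY i parB (F u) (Λ u) ι) (ball (0 : Fin (d + 1) → Site (PV d ℓ i.m i.K hd hL) 0 → 𝔸) Rc) :=
  differentiableOn_trLiftY_apply (qK i) (fun u => qT i parB (F u)) (Rc := Rc) hQh hQhi (Ψ := Λ) hΛ ι

/-- ★★ `u ↦ ((Q*(F u) ∘ a ∘ Q(F u))Λ)(b)` IS HOLOMORPHIC along ANY family `F`, for every fixed `Λ`, `b`, given `hQh ∕ hQhi` (75 `differentiableOn_QsaQ_prodCfg`, transporter-generic).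
[cite: Balaban1985BackgroundPropagators, (3.26) p.395, (3.12)–(3.13) p.392, Thm 3.4 and (3.50) p.400] -/
theorem differentiableOn_QsaQ_of_family
    (hQh : ∀ ι b, DifferentiableOn ℂ (fun u => (qT i parB (F u) ι b : 𝔸)) (ball (0 : Fin (d + 1) → Site (PV d ℓ i.m i.K hd hL) 0 → 𝔸) Rc))
    (hQhi : ∀ ι b, DifferentiableOn ℂ (fun u => (((qT i parB (F u) ι b)⁻¹ : 𝔸ˣ) : 𝔸)) (ball (0 : Fin (d + 1) → Site (PV d ℓ i.m i.K hd hL) 0 → 𝔸) Rc))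
    (Λ : FBondY i → 𝔸) (b : FBondY i) :
    DifferentiableOn ℂ (fun u => (QsY i parB (F u) ∘ₗ aY i ∘ₗ QY i parB (F u)) Λ b)
      (ball (0 : Fin (d + 1) → Site (PV d ℓ i.m i.K hd hL) 0 → 𝔸) Rc) := by
  simp only [LinearMap.comp_apply]
  refine differentiableOn_trLiftY_apply (qsK i) (fun u b ι => (qT i parB (F u) ι b)⁻¹) (Rc := Rc) (fun b ι => hQhi ι b) (fun b ι => ?_)
    (Ψ := fun u => aY i (QY i parB (F u) Λ)) (fun ι => ?_) b
  · simpa only [inv_inv] using hQh ι b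
  · exact differentiableOn_aY_apply i (fun ι' => differentiableOn_QY_apply_of_family i parB F hQh hQhi (Λ := fun _ => Λ)
      (fun x => differentiableOn_const (Λ x)) ι') ι

/-- ★ The bond averaging of a fixed field along ANY family is bounded by `c_Q·(K_Q·‖Λ‖·K_Q)` on the ball, given ONE transporter numeral `0 ≤ K_Q` on `qK`'s support
(`hQf ∕ hQb`; 75 `norm_QY_prodCfg_apply_le`, transporter-generic). [cite: Balaban1985BackgroundPropagators, (3.12) p.392, (3.40) p.397, Thm 3.4 p.400] -/
theorem norm_QY_apply_le_of_family (hKQ : 0 ≤ KQ)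
    (hQf : ∀ u ∈ ball (0 : Fin (d + 1) → Site (PV d ℓ i.m i.K hd hL) 0 → 𝔸) Rc, ∀ ι b, qK i ι b ≠ 0 → ‖(qT i parB (F u) ι b : 𝔸)‖ ≤ KQ)
    (hQb : ∀ u ∈ ball (0 : Fin (d + 1) → Site (PV d ℓ i.m i.K hd hL) 0 → 𝔸) Rc, ∀ ι b, qK i ι b ≠ 0 → ‖(((qT i parB (F u) ι b)⁻¹ : 𝔸ˣ) : 𝔸)‖ ≤ KQ)
    {cQ : ℝ} (hcQ : ∀ ι, ∑ b, |qK i ι b| ≤ cQ)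
    (Λ : FBondY i → 𝔸) {u : Fin (d + 1) → Site (PV d ℓ i.m i.K hd hL) 0 → 𝔸} (hu : u ∈ ball 0 Rc) (ι : IBondY i) :
    ‖QY i parB (F u) Λ ι‖ ≤ cQ * (KQ * ‖Λ‖ * KQ) := by
  refine (norm_trLiftY_apply_le_of_support (qK i) (fun u => qT i parB (F u)) hKQ hQf hQb
    (Ψ := fun _ => Λ) (fun _ _ b => norm_le_pi_norm Λ b) hu ι).trans ?_
  exact mul_le_mul_of_nonneg_right (hcQ ι) (mul_nonneg (mul_nonneg hKQ (norm_nonneg _)) hKQ)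

/-- ★ **THE SANDWICH BOUND ALONG ANY FAMILY**: `‖((Q*aQ)(F u)Λ)(b)‖ ≤ c_{Q*}·(K_Q·(c_a·(c_Q·(K_Q‖Λ‖K_Q)))·K_Q)` on the ball, given the transporter numeral `K_Q` on
`qK`'s support (`hQf ∕ hQb`) and on `qsK`'s support (`hQsf` for the inverse, `hQsb` for the transporter itself), the row sums `c_Q, c_a ≥ 0`, `c_{Q*}` (75
`norm_QsaQ_prodCfg_le`, transporter-generic). [cite: Balaban1985BackgroundPropagators, (3.26) p.395, (3.12)–(3.13) p.392, Thm 3.4 p.400] -/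
theorem norm_QsaQ_le_of_family (hKQ : 0 ≤ KQ)
    (hQf : ∀ u ∈ ball (0 : Fin (d + 1) → Site (PV d ℓ i.m i.K hd hL) 0 → 𝔸) Rc, ∀ ι b, qK i ι b ≠ 0 → ‖(qT i parB (F u) ι b : 𝔸)‖ ≤ KQ)
    (hQb : ∀ u ∈ ball (0 : Fin (d + 1) → Site (PV d ℓ i.m i.K hd hL) 0 → 𝔸) Rc, ∀ ι b, qK i ι b ≠ 0 → ‖(((qT i parB (F u) ι b)⁻¹ : 𝔸ˣ) : 𝔸)‖ ≤ KQ)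
    (hQsf : ∀ u ∈ ball (0 : Fin (d + 1) → Site (PV d ℓ i.m i.K hd hL) 0 → 𝔸) Rc, ∀ b ι, qsK i b ι ≠ 0 → ‖(((qT i parB (F u) ι b)⁻¹ : 𝔸ˣ) : 𝔸)‖ ≤ KQ)
    (hQsb : ∀ u ∈ ball (0 : Fin (d + 1) → Site (PV d ℓ i.m i.K hd hL) 0 → 𝔸) Rc, ∀ b ι, qsK i b ι ≠ 0 → ‖(qT i parB (F u) ι b : 𝔸)‖ ≤ KQ)
    {cQ cQs ca : ℝ} (hcQ0 : 0 ≤ cQ) (hca0 : 0 ≤ ca) (hcQ : ∀ ι, ∑ b, |qK i ι b| ≤ cQ) (hcQs : ∀ b, ∑ ι, |qsK i b ι| ≤ cQs)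
    (hca : ∀ ι, ∑ ι', |aK i ι ι'| ≤ ca)
    (Λ : FBondY i → 𝔸) {u : Fin (d + 1) → Site (PV d ℓ i.m i.K hd hL) 0 → 𝔸} (hu : u ∈ ball 0 Rc) (b : FBondY i) :
    ‖(QsY i parB (F u) ∘ₗ aY i ∘ₗ QY i parB (F u)) Λ b‖ ≤ cQs * (KQ * (ca * (cQ * (KQ * ‖Λ‖ * KQ))) * KQ) := by
  simp only [LinearMap.comp_apply]
  have hΨ : ∀ u ∈ ball (0 : Fin (d + 1) → Site (PV d ℓ i.m i.K hd hL) 0 → 𝔸) Rc, ∀ ι,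
      ‖aY i (QY i parB (F u) Λ) ι‖ ≤ ca * (cQ * (KQ * ‖Λ‖ * KQ)) :=
    fun u hu ι => (norm_aY_apply_le i (Ψ := fun u => QY i parB (F u) Λ)
      (fun u hu ι' => norm_QY_apply_le_of_family i parB F hKQ hQf hQb hcQ Λ hu ι') hu ι).trans
      (mul_le_mul_of_nonneg_right (hca ι) (mul_nonneg hcQ0 (mul_nonneg (mul_nonneg hKQ (norm_nonneg _)) hKQ)))
  have hTb : ∀ u ∈ ball (0 : Fin (d + 1) → Site (PV d ℓ i.m i.K hd hL) 0 → 𝔸) Rc, ∀ (b : FBondY i) (ι : IBondY i), qsK i b ι ≠ 0 →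
      ‖((((qT i parB (F u) ι b)⁻¹)⁻¹ : 𝔸ˣ) : 𝔸)‖ ≤ KQ := by
    intro u hu b ι hM
    rw [inv_inv]
    exact hQsb u hu b ι hM
  have h := norm_trLiftY_apply_le_of_support (qsK i) (fun u b ι => (qT i parB (F u) ι b)⁻¹) hKQ hQsf hTb
    (Ψ := fun u => aY i (QY i parB (F u) Λ)) hΨ hu b
  refine h.trans (mul_le_mul_of_nonneg_right (hcQs b) (mul_nonneg (mul_nonneg hKQ ?_) hKQ))
  exact mul_nonneg hca0 (mul_nonneg hcQ0 (mul_nonneg (mul_nonneg hKQ (norm_nonneg _)) hKQ))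

/-- ★ **THE LOCAL PART ALONG ANY FAMILY IS HOLOMORPHIC**: `u ↦ (Δ(F u)Λ)(b) + ((Q*aQ)(F u)Λ)(b)`, given the Hessian holomorphy `hHh` and `hQh ∕ hQhi`.
[cite: Balaban1985BackgroundPropagators, (3.26) p.395, (3.10) p.392, Thm 3.4 and (3.50) p.400] -/
theorem differentiableOn_localDeltaA_of_family
    (hHh : ∀ Λ b, DifferentiableOn ℂ (fun u => hessY i (F u) Λ b) (ball (0 : Fin (d + 1) → Site (PV d ℓ i.m i.K hd hL) 0 → 𝔸) Rc))
    (hQh : ∀ ι b, DifferentiableOn ℂ (fun u => (qT i parB (F u) ι b : 𝔸)) (ball (0 : Fin (d + 1) → Site (PV d ℓ i.m i.K hd hL) 0 → 𝔸) Rc))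
    (hQhi : ∀ ι b, DifferentiableOn ℂ (fun u => (((qT i parB (F u) ι b)⁻¹ : 𝔸ˣ) : 𝔸)) (ball (0 : Fin (d + 1) → Site (PV d ℓ i.m i.K hd hL) 0 → 𝔸) Rc))
    (Λ : FBondY i → 𝔸) (b : FBondY i) :
    DifferentiableOn ℂ (fun u => hessY i (F u) Λ b + (QsY i parB (F u) ∘ₗ aY i ∘ₗ QY i parB (F u)) Λ b)
      (ball (0 : Fin (d + 1) → Site (PV d ℓ i.m i.K hd hL) 0 → 𝔸) Rc) :=
  (hHh Λ b).add (differentiableOn_QsaQ_of_family i parB F hQh hQhi Λ b)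

/-- ★ **… WITH THE BOUND** `‖(Δ(F u)Λ)(b) + ((Q*aQ)(F u)Λ)(b)‖ ≤ M_H‖Λ‖ + c_{Q*}(K_Q(c_a(c_Q(K_Q‖Λ‖K_Q)))K_Q)` on the ball, given ONE Hessian numeral `M_H` (`hH`) and the
transporter numeral `K_Q`. [cite: Balaban1985BackgroundPropagators, (3.26) p.395, Thm 3.4 p.400] -/
theorem norm_localDeltaA_le_of_family (hKQ : 0 ≤ KQ)
    (hH : ∀ u ∈ ball (0 : Fin (d + 1) → Site (PV d ℓ i.m i.K hd hL) 0 → 𝔸) Rc, ∀ (Λ : FBondY i → 𝔸) (b : FBondY i), ‖hessY i (F u) Λ b‖ ≤ MH * ‖Λ‖)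
    (hQf : ∀ u ∈ ball (0 : Fin (d + 1) → Site (PV d ℓ i.m i.K hd hL) 0 → 𝔸) Rc, ∀ ι b, qK i ι b ≠ 0 → ‖(qT i parB (F u) ι b : 𝔸)‖ ≤ KQ)
    (hQb : ∀ u ∈ ball (0 : Fin (d + 1) → Site (PV d ℓ i.m i.K hd hL) 0 → 𝔸) Rc, ∀ ι b, qK i ι b ≠ 0 → ‖(((qT i parB (F u) ι b)⁻¹ : 𝔸ˣ) : 𝔸)‖ ≤ KQ)
    (hQsf : ∀ u ∈ ball (0 : Fin (d + 1) → Site (PV d ℓ i.m i.K hd hL) 0 → 𝔸) Rc, ∀ b ι, qsK i b ι ≠ 0 → ‖(((qT i parB (F u) ι b)⁻¹ : 𝔸ˣ) : 𝔸)‖ ≤ KQ)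
    (hQsb : ∀ u ∈ ball (0 : Fin (d + 1) → Site (PV d ℓ i.m i.K hd hL) 0 → 𝔸) Rc, ∀ b ι, qsK i b ι ≠ 0 → ‖(qT i parB (F u) ι b : 𝔸)‖ ≤ KQ)
    {cQ cQs ca : ℝ} (hcQ0 : 0 ≤ cQ) (hca0 : 0 ≤ ca) (hcQ : ∀ ι, ∑ b, |qK i ι b| ≤ cQ) (hcQs : ∀ b, ∑ ι, |qsK i b ι| ≤ cQs)
    (hca : ∀ ι, ∑ ι', |aK i ι ι'| ≤ ca)
    (Λ : FBondY i → 𝔸) {u : Fin (d + 1) → Site (PV d ℓ i.m i.K hd hL) 0 → 𝔸} (hu : u ∈ ball 0 Rc) (b : FBondY i) :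
    ‖hessY i (F u) Λ b + (QsY i parB (F u) ∘ₗ aY i ∘ₗ QY i parB (F u)) Λ b‖ ≤
      MH * ‖Λ‖ + cQs * (KQ * (ca * (cQ * (KQ * ‖Λ‖ * KQ))) * KQ) :=
  (norm_add_le _ _).trans (add_le_add (hH u hu Λ b) (norm_QsaQ_le_of_family i parB F hKQ hQf hQb hQsf hQsb hcQ0 hca0 hcQ hcQs hca Λ hu b))

/-- The coordinates of the local part along ANY family are holomorphic: `u ↦ φ((Δ(F u)Λ)(b) + ((Q*aQ)(F u)Λ)(b))` for every continuous linear `φ : 𝔸 → ℂ` (76 §3, family form).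
[cite: Balaban1985BackgroundPropagators, (3.26) p.395, Thm 3.4 and (3.50) p.400] -/
theorem differentiableOn_coord_localDeltaA_of_family
    (hHh : ∀ Λ b, DifferentiableOn ℂ (fun u => hessY i (F u) Λ b) (ball (0 : Fin (d + 1) → Site (PV d ℓ i.m i.K hd hL) 0 → 𝔸) Rc))
    (hQh : ∀ ι b, DifferentiableOn ℂ (fun u => (qT i parB (F u) ι b : 𝔸)) (ball (0 : Fin (d + 1) → Site (PV d ℓ i.m i.K hd hL) 0 → 𝔸) Rc))
    (hQhi : ∀ ι b, DifferentiableOn ℂ (fun u => (((qT i parB (F u) ι b)⁻¹ : 𝔸ˣ) : 𝔸)) (ball (0 : Fin (d + 1) → Site (PV d ℓ i.m i.K hd hL) 0 → 𝔸) Rc))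
    (φ : 𝔸 →L[ℂ] ℂ) (Λ : FBondY i → 𝔸) (b : FBondY i) :
    DifferentiableOn ℂ (fun u => φ (hessY i (F u) Λ b + (QsY i parB (F u) ∘ₗ aY i ∘ₗ QY i parB (F u)) Λ b))
      (ball (0 : Fin (d + 1) → Site (PV d ℓ i.m i.K hd hL) 0 → 𝔸) Rc) :=
  φ.differentiable.comp_differentiableOn (differentiableOn_localDeltaA_of_family i parB F hHh hQh hQhi Λ b)

end Family

/-! ## §2. ★★ The square `RawEntryLetters` packaging of the local part along ANY family (76 §4, family form) -/

section Packaging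

variable {ν : ℕ} {Nf : Fin ν → ℕ} [∀ j, NeZero (Nf j)]
variable {κ : Type} [Fintype κ] [DecidableEq κ] (b : Basis κ ℂ 𝔸)

open Classical in
/-- ★★ **STATION W5 — THE LOCAL PART `Δ(U) + Q*(U)aQ(U)` OF `Δ_a` ALONG ANY HOLOMORPHIC BACKGROUND FAMILY AS AN N10 LETTER DATUM** (square case, index `FBondY i × κ`,
locations `(b,k) ↦ ℓB b`; ANY transporter letter `parB`): for EVERY `ρ ≥ 0`,
`RawEntryLetters (u ↦ toMatrix B′ B′ (Δ(F u) + (Q*aQ)(F u))) (ℓB ∘ fst) Rc ρ (cb·(M_H·cl + c_{Q*}(K_Q(c_a(c_Q(K_Q·cl·K_Q)))K_Q))·e^{ρs})`.  DISPLAYED: the Hessian facts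
`hHh` (holomorphy) ∕ `hH` (`‖(Δ(F u)Λ)(b)‖ ≤ M_H‖Λ‖`, `0 ≤ M_H`), the bond-averaging transporter facts `hQh hQhi` (holomorphy) ∕ `hQf hQb hQsf hQsb` (ONE numeral
`0 ≤ K_Q` on the supports of `qK ∕ qsK`), the row sums `c_Q, c_{Q*}, c_a ≥ 0`, the basis numerals `cb, cl ≥ 0` (`‖b.repr a k‖ ≤ cb‖a‖`, `‖b_l‖ ≤ cl`) and 76 §2's reading
numeral `s` (`hℓp ∕ hℓq`).  Proof = 76 §4's: holomorphy §1 at `φ := (b.coord k).mkContinuous cb`; bound §1; range 76 §2; packaging 56A `rawEntryLetters_of_range_family` +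
`rawEntryLetters_toMatrix_of_coordFamily`.  The plain pencil is §3; the (3.37)-scaled pencil feeds dag-n10-w3's W3 ∕ dag-n10-w5's W4 numerals into the same binders.
[cite: Balaban1985BackgroundPropagators, (3.26) p.395, (3.10) p.392, (3.35)–(3.37) p.396, Thm 3.4 and (3.50) p.400, Thm 3.10 (3.107)–(3.108) p.416; Balaban1988RG2Cluster, (2.5) p.12, p.15] -/
theorem rawEntryLetters_toMatrix_localDeltaA_of_family
    (hHh : ∀ Λ b', DifferentiableOn ℂ (fun u => hessY i (F u) Λ b') (ball (0 : Fin (d + 1) → Site (PV d ℓ i.m i.K hd hL) 0 → 𝔸) Rc))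
    (hMH : 0 ≤ MH)
    (hH : ∀ u ∈ ball (0 : Fin (d + 1) → Site (PV d ℓ i.m i.K hd hL) 0 → 𝔸) Rc, ∀ (Λ : FBondY i → 𝔸) (b' : FBondY i), ‖hessY i (F u) Λ b'‖ ≤ MH * ‖Λ‖)
    (hQh : ∀ ι b', DifferentiableOn ℂ (fun u => (qT i parB (F u) ι b' : 𝔸)) (ball (0 : Fin (d + 1) → Site (PV d ℓ i.m i.K hd hL) 0 → 𝔸) Rc))
    (hQhi : ∀ ι b', DifferentiableOn ℂ (fun u => (((qT i parB (F u) ι b')⁻¹ : 𝔸ˣ) : 𝔸)) (ball (0 : Fin (d + 1) → Site (PV d ℓ i.m i.K hd hL) 0 → 𝔸) Rc))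
    (hKQ : 0 ≤ KQ)
    (hQf : ∀ u ∈ ball (0 : Fin (d + 1) → Site (PV d ℓ i.m i.K hd hL) 0 → 𝔸) Rc, ∀ ι b', qK i ι b' ≠ 0 → ‖(qT i parB (F u) ι b' : 𝔸)‖ ≤ KQ)
    (hQb : ∀ u ∈ ball (0 : Fin (d + 1) → Site (PV d ℓ i.m i.K hd hL) 0 → 𝔸) Rc, ∀ ι b', qK i ι b' ≠ 0 → ‖(((qT i parB (F u) ι b')⁻¹ : 𝔸ˣ) : 𝔸)‖ ≤ KQ)
    (hQsf : ∀ u ∈ ball (0 : Fin (d + 1) → Site (PV d ℓ i.m i.K hd hL) 0 → 𝔸) Rc, ∀ b' ι, qsK i b' ι ≠ 0 → ‖(((qT i parB (F u) ι b')⁻¹ : 𝔸ˣ) : 𝔸)‖ ≤ KQ)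
    (hQsb : ∀ u ∈ ball (0 : Fin (d + 1) → Site (PV d ℓ i.m i.K hd hL) 0 → 𝔸) Rc, ∀ b' ι, qsK i b' ι ≠ 0 → ‖(qT i parB (F u) ι b' : 𝔸)‖ ≤ KQ)
    {cQ cQs ca : ℝ} (hcQ0 : 0 ≤ cQ) (hcQs0 : 0 ≤ cQs) (hca0 : 0 ≤ ca) (hcQ : ∀ ι, ∑ b', |qK i ι b'| ≤ cQ) (hcQs : ∀ b', ∑ ι, |qsK i b' ι| ≤ cQs)
    (hca : ∀ ι, ∑ ι', |aK i ι ι'| ≤ ca)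
    {cb cl : ℝ} (hcb : ∀ (a : 𝔸) (k : κ), ‖b.repr a k‖ ≤ cb * ‖a‖) (hcb0 : 0 ≤ cb) (hcl : ∀ l, ‖b l‖ ≤ cl) (hcl0 : 0 ≤ cl)
    (ℓB : FBondY i → UT Nf) {s : ℝ}
    (hℓp : ∀ p m l, tdist1 Nf (ℓB (edgeY i p m)) (ℓB (edgeY i p l)) ≤ s)
    (hℓq : ∀ b₁ ι ι' b₂, qsK i b₁ ι ≠ 0 → aK i ι ι' ≠ 0 → qK i ι' b₂ ≠ 0 → tdist1 Nf (ℓB b₁) (ℓB b₂) ≤ s)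
    {ρ : ℝ} (hρ : 0 ≤ ρ) :
    RawEntryLetters (fun u : Fin (d + 1) → Site (PV d ℓ i.m i.K hd hL) 0 → 𝔸 =>
        LinearMap.toMatrix ((Pi.basis fun _ : FBondY i => b).reindex (Equiv.sigmaEquivProd (FBondY i) κ))
          ((Pi.basis fun _ : FBondY i => b).reindex (Equiv.sigmaEquivProd (FBondY i) κ))
          (hessY i (F u) + QsY i parB (F u) ∘ₗ aY i ∘ₗ QY i parB (F u)))
      (fun p : FBondY i × κ => ℓB p.1) Rc ρ
      (cb * (MH * cl + cQs * (KQ * (ca * (cQ * (KQ * cl * KQ))) * KQ)) * Real.exp (ρ * s)) := by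
  -- the coordinate functionals as continuous linear maps, from the numeral `cb`
  set φ : κ → 𝔸 →L[ℂ] ℂ := fun k => (b.coord k).mkContinuous cb (fun a => by rw [Basis.coord_apply]; exact hcb a k) with hφ
  have hφapp : ∀ k (a : 𝔸), φ k a = b.coord k a := fun k a => LinearMap.mkContinuous_apply _ _ _ _
  -- the majorant is linear in `‖Λ‖`: factor it
  have eP : ∀ t : ℝ, MH * t + cQs * (KQ * (ca * (cQ * (KQ * t * KQ))) * KQ) = t * (MH + cQs * ca * cQ * (KQ * KQ * (KQ * KQ))) := by
    intro t; ring
  have hA : 0 ≤ MH + cQs * ca * cQ * (KQ * KQ * (KQ * KQ)) :=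
    add_nonneg hMH (mul_nonneg (mul_nonneg (mul_nonneg hcQs0 hca0) hcQ0) (mul_nonneg (mul_nonneg hKQ hKQ) (mul_nonneg hKQ hKQ)))
  have hM0 : 0 ≤ MH * cl + cQs * (KQ * (ca * (cQ * (KQ * cl * KQ))) * KQ) := by rw [eP]; exact mul_nonneg hcl0 hA
  refine rawEntryLetters_toMatrix_of_coordFamily b (fun u => hessY i (F u) + QsY i parB (F u) ∘ₗ aY i ∘ₗ QY i parB (F u)) ?_
  refine rawEntryLetters_of_range_family (fun p q => ?_) hρ (mul_nonneg hcb0 hM0) (fun u _ p q hne => ?_) (fun u hu p q => ?_)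
  · -- holomorphy: §1 at `φ_k := (b.coord k).mkContinuous cb`
    exact (differentiableOn_coord_localDeltaA_of_family i parB F hHh hQh hQhi (φ p.2) (Pi.single q.1 (b q.2)) p.1).congr fun u _ => (hφapp p.2 _).symm
  · -- range: 76 §2 (any `parB`, any `U := F u`)
    simp only [LinearMap.add_apply, Pi.add_apply] at hne
    refine tdist_le_of_localDeltaA_single_ne_zero i ℓB hℓp hℓq (parB := parB) (U := F u) (E := b q.2) fun h0 => hne ?_
    rw [h0, map_zero]
  · -- bound: `cb` × the §1 majorant at `‖Λ‖ = ‖δ_{b′} ⊗ b_l‖ = ‖b_l‖ ≤ cl`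
    have hΛ : ‖(Pi.single q.1 (b q.2) : FBondY i → 𝔸)‖ ≤ cl := by rw [Pi.norm_single]; exact hcl q.2
    have h1 := norm_localDeltaA_le_of_family i parB F hKQ hH hQf hQb hQsf hQsb hcQ0 hca0 hcQ hcQs hca (Pi.single q.1 (b q.2)) hu p.1
    have hmono : MH * ‖(Pi.single q.1 (b q.2) : FBondY i → 𝔸)‖ +
          cQs * (KQ * (ca * (cQ * (KQ * ‖(Pi.single q.1 (b q.2) : FBondY i → 𝔸)‖ * KQ))) * KQ) ≤
        MH * cl + cQs * (KQ * (ca * (cQ * (KQ * cl * KQ))) * KQ) := by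
      rw [eP, eP]
      exact mul_le_mul_of_nonneg_right hΛ hA
    calc ‖b.coord p.2 ((hessY i (F u) + QsY i parB (F u) ∘ₗ aY i ∘ₗ QY i parB (F u)) (Pi.single q.1 (b q.2)) p.1)‖
        ≤ cb * ‖hessY i (F u) (Pi.single q.1 (b q.2)) p.1 + (QsY i parB (F u) ∘ₗ aY i ∘ₗ QY i parB (F u)) (Pi.single q.1 (b q.2)) p.1‖ := by
          rw [Basis.coord_apply]; exact hcb _ _
      _ ≤ cb * (MH * cl + cQs * (KQ * (ca * (cQ * (KQ * cl * KQ))) * KQ)) := mul_le_mul_of_nonneg_left (h1.trans hmono) hcb0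

end Packaging

/-! ## §3. ★ The instance of record: the plain pencil `F := prodCfg U₀ η`, `parB := parBY` — 73's and 71's facts fed by name (= 76 §4 up to bracketing) -/

section Pencil

variable [NormOneClass 𝔸]
variable {ν : ℕ} {Nf : Fin ν → ℕ} [∀ j, NeZero (Nf j)]
variable {κ : Type} [Fintype κ] [DecidableEq κ] (b : Basis κ ℂ 𝔸)
variable (U₀ : CfgY 𝔸 i) (η : ℝ) {K₀ : ℝ} {D : ℕ}

open Classical in
/-- ★ **THE PLAIN PENCIL AS AN INSTANCE OF §2** — `F := prodCfg U₀ η`, `parB := parBY`: the transporter facts are 73's (`differentiableOn_qT(_inv)_prodCfg`,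
`norm_qT(_inv)_prodCfg_le` with the support-length numeral `D`, so `K_Q = (K₀e^{|η|Rc})^D`), the Hessian facts 71's (`differentiableOn_hessY_prodCfg`, `norm_hessY_prodCfg_le`
with `c₁, c₂, N_b`, so `M_H = c₂c₁K_η⁸ + 8N_bc_f²K_η⁸`, `K_η = K₀e^{|η|Rc}`): `RawEntryLetters (A′ ↦ toMatrix B′B′ (Δ(e^{iηA′}U₀) + (Q*aQ)(e^{iηA′}U₀))) (ℓB ∘ fst) Rc ρ
(cb·(M_H·cl + c_{Q*}(K_Q(c_a(c_Q(K_Q·cl·K_Q)))K_Q))·e^{ρs})` — the lane's 76 §4 with its constant re-bracketed (consistency of the sockets; consumers keep using 76 §4).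
[cite: Balaban1985BackgroundPropagators, (3.26) p.395, (3.10) p.392, (3.12)–(3.13) p.392, (3.40) p.397, Thm 3.4 and (3.50) p.400, Thm 3.10 (3.107)–(3.108) p.416; Balaban1988RG2Cluster, (2.5) p.12, p.15] -/
theorem rawEntryLetters_toMatrix_localDeltaA_prodCfg_of_family
    (hU : ∀ μ x, ‖(U₀ μ x : 𝔸)‖ ≤ K₀) (hUi : ∀ μ x, ‖(((U₀ μ x)⁻¹ : 𝔸ˣ) : 𝔸)‖ ≤ K₀) (hK1 : 1 ≤ K₀) (hRc : 0 ≤ Rc)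
    {c₁ c₂ : ℝ} (hc₀ : 0 ≤ c₁) (hc₂0 : 0 ≤ c₂) (hc₁ : ∀ p, ∑ b', |curlK i p b'| ≤ c₁) (hc₂ : ∀ b', ∑ p, |cocurlK i b' p| ≤ c₂)
    {Nb : ℝ} (hNb0 : 0 ≤ Nb)
    (hNb : ∀ b' : FBondY i,
      ((((Finset.univ : Finset (PlaqY i)) ×ˢ (Finset.univ : Finset (Fin 4))).filter fun pm => edgeY i pm.1 pm.2 = b').card : ℝ) ≤ Nb)
    (hD : ∀ ι b', qK i ι b' ≠ 0 → Site.tdist (embIter (ι.1.1 : ℕ) ι.1.2.src) b'.src ≤ D)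
    (hD' : ∀ b' ι, qsK i b' ι ≠ 0 → Site.tdist (embIter (ι.1.1 : ℕ) ι.1.2.src) b'.src ≤ D)
    {cQ cQs ca : ℝ} (hcQ0 : 0 ≤ cQ) (hcQs0 : 0 ≤ cQs) (hca0 : 0 ≤ ca) (hcQ : ∀ ι, ∑ b', |qK i ι b'| ≤ cQ) (hcQs : ∀ b', ∑ ι, |qsK i b' ι| ≤ cQs)
    (hca : ∀ ι, ∑ ι', |aK i ι ι'| ≤ ca)
    {cb cl : ℝ} (hcb : ∀ (a : 𝔸) (k : κ), ‖b.repr a k‖ ≤ cb * ‖a‖) (hcb0 : 0 ≤ cb) (hcl : ∀ l, ‖b l‖ ≤ cl) (hcl0 : 0 ≤ cl)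
    (ℓB : FBondY i → UT Nf) {s : ℝ}
    (hℓp : ∀ p m l, tdist1 Nf (ℓB (edgeY i p m)) (ℓB (edgeY i p l)) ≤ s)
    (hℓq : ∀ b₁ ι ι' b₂, qsK i b₁ ι ≠ 0 → aK i ι ι' ≠ 0 → qK i ι' b₂ ≠ 0 → tdist1 Nf (ℓB b₁) (ℓB b₂) ≤ s)
    {ρ : ℝ} (hρ : 0 ≤ ρ) :
    RawEntryLetters (fun a : Fin (d + 1) → Site (PV d ℓ i.m i.K hd hL) 0 → 𝔸 =>
        LinearMap.toMatrix ((Pi.basis fun _ : FBondY i => b).reindex (Equiv.sigmaEquivProd (FBondY i) κ))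
          ((Pi.basis fun _ : FBondY i => b).reindex (Equiv.sigmaEquivProd (FBondY i) κ))
          (hessY i (prodCfg U₀ η a) + QsY i (parBY i) (prodCfg U₀ η a) ∘ₗ aY i ∘ₗ QY i (parBY i) (prodCfg U₀ η a)))
      (fun p : FBondY i × κ => ℓB p.1) Rc ρ
      (cb * ((c₂ * c₁ * (K₀ * Real.exp (|η| * Rc)) ^ 8 + 8 * (Nb * i.cf ^ 2) * (K₀ * Real.exp (|η| * Rc)) ^ 8) * cl +
        cQs * ((K₀ * Real.exp (|η| * Rc)) ^ D * (ca * (cQ * ((K₀ * Real.exp (|η| * Rc)) ^ D * cl * (K₀ * Real.exp (|η| * Rc)) ^ D))) *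
          (K₀ * Real.exp (|η| * Rc)) ^ D)) * Real.exp (ρ * s)) := by
  set Kη : ℝ := K₀ * Real.exp (|η| * Rc) with hKη
  have h1 : (1 : ℝ) ≤ Kη := one_le_mul_of_one_le_of_one_le hK1 (Real.one_le_exp (mul_nonneg (abs_nonneg _) hRc))
  have hKη0 : 0 ≤ Kη := zero_le_one.trans h1
  have h0 : (0 : ℝ) ≤ Kη ^ D := pow_nonneg hKη0 D
  -- 71's Hessian majorant is `M_H·‖Λ‖` with `M_H = c₂c₁K_η⁸ + 8N_bc_f²K_η⁸`
  have hMH : 0 ≤ c₂ * c₁ * Kη ^ 8 + 8 * (Nb * i.cf ^ 2) * Kη ^ 8 :=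
    add_nonneg (mul_nonneg (mul_nonneg hc₂0 hc₀) (pow_nonneg hKη0 _)) (mul_nonneg (mul_nonneg (by norm_num) (mul_nonneg hNb0 (sq_nonneg _))) (pow_nonneg hKη0 _))
  have hH : ∀ u ∈ ball (0 : Fin (d + 1) → Site (PV d ℓ i.m i.K hd hL) 0 → 𝔸) Rc, ∀ (Λ : FBondY i → 𝔸) (b' : FBondY i),
      ‖hessY i (prodCfg U₀ η u) Λ b'‖ ≤ (c₂ * c₁ * Kη ^ 8 + 8 * (Nb * i.cf ^ 2) * Kη ^ 8) * ‖Λ‖ := by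
    intro u hu Λ b'
    refine (norm_hessY_prodCfg_le i U₀ η hU hUi hK1 hRc hc₀ hc₁ hc₂ b' (hNb b') Λ hu).trans (le_of_eq ?_)
    simp only [hKη]; ring
  exact rawEntryLetters_toMatrix_localDeltaA_of_family i (parBY i) (fun a => prodCfg U₀ η a) b (fun Λ b' => differentiableOn_hessY_prodCfg i U₀ η Λ b')
    hMH hH (fun ι b' => differentiableOn_qT_prodCfg i U₀ η ι b') (fun ι b' => differentiableOn_qT_inv_prodCfg i U₀ η ι b') h0
    (fun u hu ι b' hM => (norm_qT_prodCfg_le i U₀ η hU hUi hRc hu ι b').trans (pow_le_pow_right₀ h1 (hD ι b' hM)))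
    (fun u hu ι b' hM => (norm_qT_inv_prodCfg_le i U₀ η hU hUi hRc hu ι b').trans (pow_le_pow_right₀ h1 (hD ι b' hM)))
    (fun u hu b' ι hM => (norm_qT_inv_prodCfg_le i U₀ η hU hUi hRc hu ι b').trans (pow_le_pow_right₀ h1 (hD' b' ι hM)))
    (fun u hu b' ι hM => (norm_qT_prodCfg_le i U₀ η hU hUi hRc hu ι b').trans (pow_le_pow_right₀ h1 (hD' b' ι hM)))
    hcQ0 hcQs0 hca0 hcQ hcQs hca hcb hcb0 hcl hcl0 ℓB hℓp hℓq hρ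

end Pencil

/-! ## §4. The (3.37)-SCALED pencil `A″ ↦ e^{iη(w·A″)}U₀` (`|w| ≤ 1`; dag-n10-w3's W3 shape): the Hessian facts and the transporter HOLOMORPHY by precomposition — only W4's level-uniform transporter NUMERAL is left to feed into §2 -/

section ScaledPencil

variable (U₀ : CfgY 𝔸 i) (η : ℝ) (w : Site (PV d ℓ i.m i.K hd hL) 0 → ℝ)

omit [CompleteSpace 𝔸] in
/-- the chart-diagonal weight scaling `A″ ↦ w·A″` is (entire) holomorphic. [cite: Balaban1985BackgroundPropagators, (3.37) p.396; folklore] -/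
theorem differentiable_weightScale :
    Differentiable ℂ (fun a : Fin (d + 1) → Site (PV d ℓ i.m i.K hd hL) 0 → 𝔸 => fun μ y => ((w y : ℝ) : ℂ) • a μ y) :=
  differentiable_pi.mpr fun μ => differentiable_pi.mpr fun y =>
    show Differentiable ℂ ((((w y : ℝ) : ℂ)) • fun a : Fin (d + 1) → Site (PV d ℓ i.m i.K hd hL) 0 → 𝔸 => a μ y) from
      ((differentiable_pi.mp (differentiable_apply (𝕜 := ℂ) μ)) y).const_smul (((w y : ℝ) : ℂ))

omit [CompleteSpace 𝔸] in
/-- … and maps the chart ball into itself when `|w| ≤ 1` (`‖w·A″‖ ≤ ‖A″‖`). [cite: Balaban1985BackgroundPropagators, (3.35)–(3.37) p.396; folklore] -/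
theorem mapsTo_weightScale_ball (hw : ∀ y, |w y| ≤ 1) :
    MapsTo (fun a : Fin (d + 1) → Site (PV d ℓ i.m i.K hd hL) 0 → 𝔸 => fun μ y => ((w y : ℝ) : ℂ) • a μ y)
      (ball (0 : Fin (d + 1) → Site (PV d ℓ i.m i.K hd hL) 0 → 𝔸) Rc) (ball 0 Rc) := by
  intro a ha
  rw [mem_ball_zero_iff] at ha ⊢
  refine lt_of_le_of_lt ((pi_norm_le_iff_of_nonneg (norm_nonneg a)).mpr fun μ => (pi_norm_le_iff_of_nonneg (norm_nonneg a)).mpr fun y => ?_) ha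
  rw [norm_smul, Complex.norm_real, Real.norm_eq_abs]
  exact (mul_le_of_le_one_left (norm_nonneg _) (hw y)).trans ((norm_le_pi_norm (a μ) y).trans (norm_le_pi_norm a μ))

/-- ★ `hHh` for the scaled pencil: `A″ ↦ (Δ(e^{iη(w·A″)}U₀)Λ)(b)` is holomorphic on the chart ball (71 ∘ the weight scaling). [cite: Balaban1985BackgroundPropagators, (3.10) p.392, (3.37) p.396, Thm 3.4 and (3.50) p.400] -/
theorem differentiableOn_hessY_scaledPencil (hw : ∀ y, |w y| ≤ 1) (Λ : FBondY i → 𝔸) (b' : FBondY i) :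
    DifferentiableOn ℂ (fun a : Fin (d + 1) → Site (PV d ℓ i.m i.K hd hL) 0 → 𝔸 => hessY i (prodCfg U₀ η (fun μ y => ((w y : ℝ) : ℂ) • a μ y)) Λ b')
      (ball (0 : Fin (d + 1) → Site (PV d ℓ i.m i.K hd hL) 0 → 𝔸) Rc) :=
  (differentiableOn_hessY_prodCfg i U₀ η Λ b' (Rc := Rc)).comp (differentiable_weightScale i w).differentiableOn (mapsTo_weightScale_ball i w hw)

/-- ★ `hQh ∕ hQhi` for the scaled pencil: the bond-averaging transporters `A″ ↦ qT i parBY (e^{iη(w·A″)}U₀) ι b` and their inverses are holomorphic (73 ∘ the weight scaling).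
[cite: Balaban1985BackgroundPropagators, (3.12)–(3.13) p.392, (3.37) p.396, Thm 3.4 p.400] -/
theorem differentiableOn_qT_scaledPencil (hw : ∀ y, |w y| ≤ 1) (ι : IBondY i) (b' : FBondY i) :
    DifferentiableOn ℂ (fun a : Fin (d + 1) → Site (PV d ℓ i.m i.K hd hL) 0 → 𝔸 => (qT i (parBY i) (prodCfg U₀ η (fun μ y => ((w y : ℝ) : ℂ) • a μ y)) ι b' : 𝔸))
      (ball (0 : Fin (d + 1) → Site (PV d ℓ i.m i.K hd hL) 0 → 𝔸) Rc) ∧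
    DifferentiableOn ℂ (fun a : Fin (d + 1) → Site (PV d ℓ i.m i.K hd hL) 0 → 𝔸 =>
        (((qT i (parBY i) (prodCfg U₀ η (fun μ y => ((w y : ℝ) : ℂ) • a μ y)) ι b')⁻¹ : 𝔸ˣ) : 𝔸))
      (ball (0 : Fin (d + 1) → Site (PV d ℓ i.m i.K hd hL) 0 → 𝔸) Rc) :=
  ⟨(differentiableOn_qT_prodCfg i U₀ η ι b' (Rc := Rc)).comp (differentiable_weightScale i w).differentiableOn (mapsTo_weightScale_ball i w hw),
    (differentiableOn_qT_inv_prodCfg i U₀ η ι b' (Rc := Rc)).comp (differentiable_weightScale i w).differentiableOn (mapsTo_weightScale_ball i w hw)⟩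

variable [NormOneClass 𝔸]

open Classical in
/-- ★ `hH` for the scaled pencil: 71's Hessian majorant AT THE SAME `K_η = K₀e^{|η|Rc}` (plaquette-local — no transport length, hence already uniform in the level) holds along
`A″ ↦ e^{iη(w·A″)}U₀`, `|w| ≤ 1`: `‖(Δ(U)Λ)(b)‖ ≤ (c₂c₁K_η⁸ + 8N_bc_f²K_η⁸)·‖Λ‖`.  With `differentiableOn_hessY_scaledPencil`, `differentiableOn_qT_scaledPencil` and dag-n10-w5's W4
level-uniform transporter numeral (`hQf hQb hQsf hQsb`), §2 gives the local part's letters along the scaled pencil — the successor's instance.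
[cite: Balaban1985BackgroundPropagators, (3.10) p.392, (3.35)–(3.37) p.396, Thm 3.4 p.400, (3.108) p.416] -/
theorem norm_hessY_scaledPencil_le (hw : ∀ y, |w y| ≤ 1) {K₀ : ℝ}
    (hU : ∀ μ x, ‖(U₀ μ x : 𝔸)‖ ≤ K₀) (hUi : ∀ μ x, ‖(((U₀ μ x)⁻¹ : 𝔸ˣ) : 𝔸)‖ ≤ K₀) (hK1 : 1 ≤ K₀) (hRc : 0 ≤ Rc)
    {c₁ c₂ : ℝ} (hc₀ : 0 ≤ c₁) (hc₁ : ∀ p, ∑ b', |curlK i p b'| ≤ c₁) (hc₂ : ∀ b', ∑ p, |cocurlK i b' p| ≤ c₂) {Nb : ℝ}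
    (hNb : ∀ b' : FBondY i,
      ((((Finset.univ : Finset (PlaqY i)) ×ˢ (Finset.univ : Finset (Fin 4))).filter fun pm => edgeY i pm.1 pm.2 = b').card : ℝ) ≤ Nb)
    {a : Fin (d + 1) → Site (PV d ℓ i.m i.K hd hL) 0 → 𝔸} (ha : a ∈ ball 0 Rc) (Λ : FBondY i → 𝔸) (b' : FBondY i) :
    ‖hessY i (prodCfg U₀ η (fun μ y => ((w y : ℝ) : ℂ) • a μ y)) Λ b'‖ ≤
      (c₂ * c₁ * (K₀ * Real.exp (|η| * Rc)) ^ 8 + 8 * (Nb * i.cf ^ 2) * (K₀ * Real.exp (|η| * Rc)) ^ 8) * ‖Λ‖ := by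
  refine (norm_hessY_prodCfg_le i U₀ η hU hUi hK1 hRc hc₀ hc₁ hc₂ b' (hNb b') Λ (mapsTo_weightScale_ball i w hw ha)).trans (le_of_eq ?_)
  ring

end ScaledPencil

end Literature.MathematicalPhysics.QuantumFieldTheory.Balaban1983to89.B13DeltaALocalFamily

end
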